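/-
COR-CM (cell pub-hodgecm2, stage 2 of the Hodge ladder) — count-neutral KERNEL COMBINATORICS «the binary tetrahedral group SL(2,3)», part VIII: the LATTICE of normal
forms (seat prover-pub-hodgecm2-b23-g53-0, binder prover b23, gen 53; claim HOME/INBOX.md l.24246, NAME ASK l.24300).  Bookkeeping definitions with bodies (the
integer tables `Gk`, `GCv`, `mu`) + theorems; `decide` only on closed identities between literal integer/Boolean tables and gen 44ʼs pattern maps at literal
patterns, no certificate, no named fact, no `sorry`.  The tables were computed by this seatʼs `work/gen/lattice.py` (bytes of record in HOME/pub-hodgecm2-b23/lean-g53/)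
and are checked here by the kernel.  `Interfaces.lean` (C1), every E term, B01, `Transposition/*`, `PortJoin/*`, `D2Bridge/*` untouched.
HONEST FRAMING: `HC_CM` is NOT proved, here or anywhere in the tree; nothing here is a period, a count of record or a headline.
T5: n/a-class (no hypothesis binders); checker: self.
-/
import Summits.HodgeConjecture.CorCM.Census.QuarticInversionLattice
import Summits.HodgeConjecture.CorCM.Census.OcticProductOrbit
import Summits.HodgeConjecture.CorCM.Census.BinaryTetrahedralTrees

/-!
# The binary tetrahedral group, VIII: the normal form of every Hodge vector lies in the value module of `B1`

THE MODEL of `SL(2,3)` is part IVʼs with `A = ℤ/3`, shear `σ = 1`; `B1` is part VIIʼs closing family (the square `S` and seven mixed faces).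
* §1 **The generator table**: the normal-form data `(k, C) ∈ ℤ⁴ × ℤ¹⁶` (gen 44ʼs `kOf`, `fnl ∘ wC`) of the nine translates `P(aᵉ·S)`, `P ∈ {1, i, k, k i}`,
  `e ∈ {0, 1, 2}` (rows `Gk`, `GCv`), and the integer matrix `mu` writing gen 44ʼs basis `(Bk l, BCv l)` of the relation lattice (`R1–R4` + oddness,
  `Census/QuarticInversionLatticeBasis`) as combinations of the rows (`B_eq_sum_G`, one `decide`).
* §2 **Every generator normal form lies in the value module of `B1`** (`ΦL_G_mem`): the translate lies in the orbit span, all slot binomials lie in the value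
  module (part VII), so its normal form does (part VI), and the normal form is the tabulated one (gen 44ʼs `kOf_sqFace`/`fnl_wC_sqFace_eq_cB` moved by
  `nf_translZ`, `nf_translT` and part VIʼs `nf_translA`).
* §3 **THE LATTICE THEOREM** (`nf_mem_valMod_of_hodge`, `Avec_mem_valMod_of_hodge`): the value vector of EVERY Hodge vector of the model lies in
  `Avec (orbSpan B1)`.
All [folklore] bookkeeping over [Pohlmann1968, Thm 1].

## References
* [Pohlmann1968] H. Pohlmann, Algebraic cycles on abelian varieties of complex multiplication type, Ann. of Math. 88 (1968), Thm 1.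
-/

namespace Summit.HodgeConjecture.CorCM.Census.BinaryTetrahedral

open Finset
open Summit.HodgeConjecture.CorCM.Census.OddSliceFacesModel
open Summit.HodgeConjecture.CorCM.Census.QuarticInversion
open Summit.HodgeConjecture.CorCM.Census.OcticProduct (twZ translZ translZ_mem nf_translZ kOf_translZ fnl_wC_translZ)

noncomputable section

/-! ## §1 The generator table and the finite check -/

/-- The column parts `k` of the nine generator normal forms (rows: `S, iS, kS, kiS, aS, iaS, kaS, kiaS, a²S`). [folklore] -/
def Gk : Fin 9 → Fin 4 → ℤ := ![![1, 0, 0, 0], ![0, -1, 0, 0], ![0, 0, -1, 0], ![0, 0, 0, -1], ![1, 0, 0, 0], ![0, -1, 0, 0], ![0, 0, -1, 0], ![0, 0, 0, -1], ![1, 0, 0, 0]]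

/-- The constant parts (as tables) of the nine generator normal forms. [folklore] -/
def GCv : Fin 9 → Fin 16 → ℤ := ![![0, 1, 0, 0, 0, 0, 1, 0, 0, -1, 0, 0, 0, 0, -1, 0],
  ![0, 0, 0, -1, 0, 0, 0, 1, -1, 0, 0, 0, 1, 0, 0, 0],
  ![-1, 0, 1, 0, 0, 0, 0, 0, 0, 0, 0, 0, 0, -1, 0, 1],
  ![0, 0, 0, 0, -1, 1, 0, 0, 0, 0, -1, 1, 0, 0, 0, 0],
  ![0, 0, 1, 0, 0, 1, 0, 0, 0, 0, -1, 0, 0, -1, 0, 0],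
  ![-1, 0, 0, 0, 1, 0, 0, 0, 0, 0, 0, -1, 0, 0, 0, 1],
  ![0, -1, 0, 1, 0, 0, 0, 0, 0, 0, 0, 0, -1, 0, 1, 0],
  ![0, 0, 0, 0, 0, 0, -1, 1, -1, 1, 0, 0, 0, 0, 0, 0],
  ![0, 0, 0, 1, 1, 0, 0, 0, 0, 0, 0, -1, -1, 0, 0, 0]]

/-- The coefficients of gen 44ʼs relation-lattice basis on the generator normal forms. [folklore] -/
def mu : Fin 8 → Fin 9 → ℤ := ![![0, 0, 0, 1, 0, 0, 0, -1, 1],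
  ![0, -1, 0, 0, 0, 0, 0, 0, 0],
  ![0, -1, -1, 0, 1, 1, 0, 0, -1],
  ![0, 0, 0, 0, 0, 0, 0, -1, 0],
  ![0, -1, 0, 1, 0, 1, 0, -1, 0],
  ![-1, 0, 0, 1, 0, 0, 0, -1, 1],
  ![0, 0, 0, 1, -1, 0, 0, -1, 1],
  ![0, 0, 0, 1, 0, 0, 0, -1, 0]]

/-- **The finite check**: every basis vector of the relation lattice is an integer combination of the generator normal forms. [folklore] -/
theorem B_eq_sum_G (l : Fin 8) : ((Bk l, BCv l) : (Fin 4 → ℤ) × (Fin 16 → ℤ)) = ∑ i : Fin 9, mu l i • (Gk i, GCv i) := by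
  fin_cases l <;> decide

/-! ## §2 Every generator normal form lies in the value module of `B1` -/

section Members


/-- **Every generator normal form lies in the value module of `B1`.** [folklore] -/
theorem ΦL_G_mem (i : Fin 9) : ΨL (ZMod 3) (Gk i, GCv i) ∈ valMod (ZMod 3) (1 : ZMod 3) (↑famB1 : Set (Ty₄ (ZMod 3) → ℤ)) := by
  have hA := odd_card_zmod_three
  have hF := famB1_subset_hodge₄
  have hbin := binVec_mem_valMod
  have h1 : (0 : ZMod 3) ∉ (∅ : Finset (ZMod 3)) := Finset.notMem_empty _
  have h2 : (1 : ZMod 3) ∉ (∅ : Finset (ZMod 3)) := Finset.notMem_empty _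
  have h12 : (0 : ZMod 3) ≠ 1 := by decide
  have hP : (∅ : Finset (ZMod 3)).card + 1 = Fintype.card (ZMod 3) / 2 := by simp
  set S0 : Ty₄ (ZMod 3) → ℤ := sqFace (ZMod 3) ∅ 0 1 ![false, false, false, true] with hS0def
  set S1 : Ty₄ (ZMod 3) → ℤ := translA (ZMod 3) 1 S0 with hS1def
  set S2 : Ty₄ (ZMod 3) → ℤ := translA (ZMod 3) 1 S1 with hS2def
  have mS0 : S0 ∈ orbSpan (ZMod 3) 1 (↑famB1 : Set (Ty₄ (ZMod 3) → ℤ)) := subset_orbSpan (ZMod 3) 1 _ mem_S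
  have mS1 : S1 ∈ orbSpan (ZMod 3) 1 (↑famB1 : Set (Ty₄ (ZMod 3) → ℤ)) := translA_mem_orbSpan (ZMod 3) 1 _ mS0
  have mS2 : S2 ∈ orbSpan (ZMod 3) 1 (↑famB1 : Set (Ty₄ (ZMod 3) → ℤ)) := translA_mem_orbSpan (ZMod 3) 1 _ mS1
  have hH0 : S0 ∈ hodge₄ (ZMod 3) := faceVec₄_mem (ZMod 3) _ (by decide)
  have hH1 : S1 ∈ hodge₄ (ZMod 3) := translA_mem (ZMod 3) 1 hH0
  have k0 : ∀ j, kOf (ZMod 3) j S0 = kS j := fun j => kOf_sqFace (ZMod 3) hA h1 h2 h12 hP _ j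
  have c0 : ∀ η, fnl (ZMod 3) (wC (ZMod 3) η) S0 = cB ![false, false, false, true] η := fun η => fnl_wC_sqFace_eq_cB (ZMod 3) hA h1 h2 h12 hP _ η
  have k1 : ∀ j, kOf (ZMod 3) j S1 = kS (ρA j) := fun j => by rw [hS1def, kOf_translA (ZMod 3) hA j hH0, k0]
  have c1 : ∀ η, fnl (ZMod 3) (wC (ZMod 3) η) S1 = cB ![false, false, false, true] ((η) ∘ σA) := fun η => by
    rw [hS1def, fnl_wC_translA, c0]
  have k2 : ∀ j, kOf (ZMod 3) j S2 = kS (ρA (ρA j)) := fun j => by rw [hS2def, kOf_translA (ZMod 3) hA j hH1, k1]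
  have c2 : ∀ η, fnl (ZMod 3) (wC (ZMod 3) η) S2 = cB ![false, false, false, true] ((((η) ∘ σA)) ∘ σA) := fun η => by
    rw [hS2def, fnl_wC_translA, c1]
  clear_value S2 S1 S0
  fin_cases i
  · show ΨL (ZMod 3) (Gk 0, GCv 0) ∈ _
    have e : ((Gk 0, tab16 (GCv 0)) : (Fin 4 → ℤ) × ((Fin 4 → Bool) → ℤ)) = ((fun j => kS (j)), (fun η => cB ![false, false, false, true] η)) :=
      Prod.ext (by decide) (funext_pat fun a b c d => by cases a <;> cases b <;> cases c <;> cases d <;> decide)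
    have h := nf_mem_of_bin (ZMod 3) hA hF hbin mS0
    have hn : nf (ZMod 3) (S0) = ΦL (ZMod 3) ((fun j => kS (j)), (fun η => cB ![false, false, false, true] η)) := by
      rw [nf_eq_ΦL]; exact congrArg (ΦL (ZMod 3)) (congrArg₂ Prod.mk (funext fun j => k0 j) (funext fun η => c0 η))
    rw [hn] at h
    rw [ΨL_apply, e]; exact h
  · show ΨL (ZMod 3) (Gk 1, GCv 1) ∈ _
    have e : ((Gk 1, tab16 (GCv 1)) : (Fin 4 → ℤ) × ((Fin 4 → Bool) → ℤ)) = ((fun j => (if bY 1 j then -1 else 1) * kS (σY j)), (fun η => cB ![false, false, false, true] (pY 1 η))) :=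
      Prod.ext (by decide) (funext_pat fun a b c d => by cases a <;> cases b <;> cases c <;> cases d <;> decide)
    have h := nf_mem_of_bin (ZMod 3) hA hF hbin (translZ_mem_orbSpan (ZMod 3) 1 _ mS0)
    have hn : nf (ZMod 3) (translZ (ZMod 3) 1 S0) = ΦL (ZMod 3) ((fun j => (if bY 1 j then -1 else 1) * kS (σY j)), (fun η => cB ![false, false, false, true] (pY 1 η))) := by
      rw [nf_translZ (ZMod 3) hA]
      exact congrArg (ΦL (ZMod 3)) (congrArg₂ Prod.mk (funext fun j => congrArg (fun x => (if bY 1 j then -1 else 1) * x) (k0 (σY j)))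
        (funext fun η => c0 (pY 1 η)))
    rw [hn] at h
    rw [ΨL_apply, e]; exact h
  · show ΨL (ZMod 3) (Gk 2, GCv 2) ∈ _
    have e : ((Gk 2, tab16 (GCv 2)) : (Fin 4 → ℤ) × ((Fin 4 → Bool) → ℤ)) = ((fun j => (if bT j then -1 else 1) * kS (σT j)), (fun η => cB ![false, false, false, true] (pT η))) :=
      Prod.ext (by decide) (funext_pat fun a b c d => by cases a <;> cases b <;> cases c <;> cases d <;> decide)
    have h := nf_mem_of_bin (ZMod 3) hA hF hbin (translT_mem_orbSpan (ZMod 3) 1 _ mS0)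
    have hn : nf (ZMod 3) (translT (ZMod 3) S0) = ΦL (ZMod 3) ((fun j => (if bT j then -1 else 1) * kS (σT j)), (fun η => cB ![false, false, false, true] (pT η))) := by
      rw [nf_translT (ZMod 3) hA]
      exact congrArg (ΦL (ZMod 3)) (congrArg₂ Prod.mk (funext fun j => congrArg (fun x => (if bT j then -1 else 1) * x) (k0 (σT j)))
        (funext fun η => c0 (pT η)))
    rw [hn] at h
    rw [ΨL_apply, e]; exact h
  · show ΨL (ZMod 3) (Gk 3, GCv 3) ∈ _
    have e : ((Gk 3, tab16 (GCv 3)) : (Fin 4 → ℤ) × ((Fin 4 → Bool) → ℤ)) = ((fun j => (if bT j then -1 else 1) * ((if bY 1 (σT j) then -1 else 1) * kS (σY (σT j)))), (fun η => cB ![false, false, false, true] (pY 1 (pT η)))) :=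
      Prod.ext (by decide) (funext_pat fun a b c d => by cases a <;> cases b <;> cases c <;> cases d <;> decide)
    have h := nf_mem_of_bin (ZMod 3) hA hF hbin (translT_mem_orbSpan (ZMod 3) 1 _ (translZ_mem_orbSpan (ZMod 3) 1 _ mS0))
    have hn : nf (ZMod 3) (translT (ZMod 3) (translZ (ZMod 3) 1 S0)) = ΦL (ZMod 3) ((fun j => (if bT j then -1 else 1) * ((if bY 1 (σT j) then -1 else 1) * kS (σY (σT j)))), (fun η => cB ![false, false, false, true] (pY 1 (pT η)))) := by
      rw [nf_translT (ZMod 3) hA]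
      exact congrArg (ΦL (ZMod 3)) (congrArg₂ Prod.mk
        (funext fun j => congrArg (fun x => (if bT j then -1 else 1) * x)
          ((kOf_translZ (ZMod 3) hA (σT j) _).trans (congrArg (fun x => (if bY 1 (σT j) then -1 else 1) * x) (k0 (σY (σT j))))))
        (funext fun η => (fnl_wC_translZ (ZMod 3) hA 1 (pT η) _).trans (c0 (pY 1 (pT η)))))
    rw [hn] at h
    rw [ΨL_apply, e]; exact h
  · show ΨL (ZMod 3) (Gk 4, GCv 4) ∈ _
    have e : ((Gk 4, tab16 (GCv 4)) : (Fin 4 → ℤ) × ((Fin 4 → Bool) → ℤ)) = ((fun j => kS (ρA (j))), (fun η => cB ![false, false, false, true] (((η) ∘ σA)))) :=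
      Prod.ext (by decide) (funext_pat fun a b c d => by cases a <;> cases b <;> cases c <;> cases d <;> decide)
    have h := nf_mem_of_bin (ZMod 3) hA hF hbin mS1
    have hn : nf (ZMod 3) (S1) = ΦL (ZMod 3) ((fun j => kS (ρA (j))), (fun η => cB ![false, false, false, true] (((η) ∘ σA)))) := by
      rw [nf_eq_ΦL]; exact congrArg (ΦL (ZMod 3)) (congrArg₂ Prod.mk (funext fun j => k1 j) (funext fun η => c1 η))
    rw [hn] at h
    rw [ΨL_apply, e]; exact h
  · show ΨL (ZMod 3) (Gk 5, GCv 5) ∈ _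
    have e : ((Gk 5, tab16 (GCv 5)) : (Fin 4 → ℤ) × ((Fin 4 → Bool) → ℤ)) = ((fun j => (if bY 1 j then -1 else 1) * kS (ρA (σY j))), (fun η => cB ![false, false, false, true] (((pY 1 η) ∘ σA)))) :=
      Prod.ext (by decide) (funext_pat fun a b c d => by cases a <;> cases b <;> cases c <;> cases d <;> decide)
    have h := nf_mem_of_bin (ZMod 3) hA hF hbin (translZ_mem_orbSpan (ZMod 3) 1 _ mS1)
    have hn : nf (ZMod 3) (translZ (ZMod 3) 1 S1) = ΦL (ZMod 3) ((fun j => (if bY 1 j then -1 else 1) * kS (ρA (σY j))), (fun η => cB ![false, false, false, true] (((pY 1 η) ∘ σA)))) := by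
      rw [nf_translZ (ZMod 3) hA]
      exact congrArg (ΦL (ZMod 3)) (congrArg₂ Prod.mk (funext fun j => congrArg (fun x => (if bY 1 j then -1 else 1) * x) (k1 (σY j)))
        (funext fun η => c1 (pY 1 η)))
    rw [hn] at h
    rw [ΨL_apply, e]; exact h
  · show ΨL (ZMod 3) (Gk 6, GCv 6) ∈ _
    have e : ((Gk 6, tab16 (GCv 6)) : (Fin 4 → ℤ) × ((Fin 4 → Bool) → ℤ)) = ((fun j => (if bT j then -1 else 1) * kS (ρA (σT j))), (fun η => cB ![false, false, false, true] (((pT η) ∘ σA)))) :=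
      Prod.ext (by decide) (funext_pat fun a b c d => by cases a <;> cases b <;> cases c <;> cases d <;> decide)
    have h := nf_mem_of_bin (ZMod 3) hA hF hbin (translT_mem_orbSpan (ZMod 3) 1 _ mS1)
    have hn : nf (ZMod 3) (translT (ZMod 3) S1) = ΦL (ZMod 3) ((fun j => (if bT j then -1 else 1) * kS (ρA (σT j))), (fun η => cB ![false, false, false, true] (((pT η) ∘ σA)))) := by
      rw [nf_translT (ZMod 3) hA]
      exact congrArg (ΦL (ZMod 3)) (congrArg₂ Prod.mk (funext fun j => congrArg (fun x => (if bT j then -1 else 1) * x) (k1 (σT j)))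
        (funext fun η => c1 (pT η)))
    rw [hn] at h
    rw [ΨL_apply, e]; exact h
  · show ΨL (ZMod 3) (Gk 7, GCv 7) ∈ _
    have e : ((Gk 7, tab16 (GCv 7)) : (Fin 4 → ℤ) × ((Fin 4 → Bool) → ℤ)) = ((fun j => (if bT j then -1 else 1) * ((if bY 1 (σT j) then -1 else 1) * kS (ρA (σY (σT j))))), (fun η => cB ![false, false, false, true] (((pY 1 (pT η)) ∘ σA)))) :=
      Prod.ext (by decide) (funext_pat fun a b c d => by cases a <;> cases b <;> cases c <;> cases d <;> decide)
    have h := nf_mem_of_bin (ZMod 3) hA hF hbin (translT_mem_orbSpan (ZMod 3) 1 _ (translZ_mem_orbSpan (ZMod 3) 1 _ mS1))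
    have hn : nf (ZMod 3) (translT (ZMod 3) (translZ (ZMod 3) 1 S1)) = ΦL (ZMod 3) ((fun j => (if bT j then -1 else 1) * ((if bY 1 (σT j) then -1 else 1) * kS (ρA (σY (σT j))))), (fun η => cB ![false, false, false, true] (((pY 1 (pT η)) ∘ σA)))) := by
      rw [nf_translT (ZMod 3) hA]
      exact congrArg (ΦL (ZMod 3)) (congrArg₂ Prod.mk
        (funext fun j => congrArg (fun x => (if bT j then -1 else 1) * x)
          ((kOf_translZ (ZMod 3) hA (σT j) _).trans (congrArg (fun x => (if bY 1 (σT j) then -1 else 1) * x) (k1 (σY (σT j))))))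
        (funext fun η => (fnl_wC_translZ (ZMod 3) hA 1 (pT η) _).trans (c1 (pY 1 (pT η)))))
    rw [hn] at h
    rw [ΨL_apply, e]; exact h
  · show ΨL (ZMod 3) (Gk 8, GCv 8) ∈ _
    have e : ((Gk 8, tab16 (GCv 8)) : (Fin 4 → ℤ) × ((Fin 4 → Bool) → ℤ)) = ((fun j => kS (ρA (ρA (j)))), (fun η => cB ![false, false, false, true] (((((η) ∘ σA)) ∘ σA)))) :=
      Prod.ext (by decide) (funext_pat fun a b c d => by cases a <;> cases b <;> cases c <;> cases d <;> decide)
    have h := nf_mem_of_bin (ZMod 3) hA hF hbin mS2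
    have hn : nf (ZMod 3) (S2) = ΦL (ZMod 3) ((fun j => kS (ρA (ρA (j)))), (fun η => cB ![false, false, false, true] (((((η) ∘ σA)) ∘ σA)))) := by
      rw [nf_eq_ΦL]; exact congrArg (ΦL (ZMod 3)) (congrArg₂ Prod.mk (funext fun j => k2 j) (funext fun η => c2 η))
    rw [hn] at h
    rw [ΨL_apply, e]; exact h

/-! ## §3 The lattice theorem -/

/-- **The normal form of every Hodge vector lies in the value module of `B1`.** [folklore] -/
theorem nf_mem_valMod_of_hodge {x : Ty₄ (ZMod 3) → ℤ} (hx : x ∈ hodge₄ (ZMod 3)) : nf (ZMod 3) x ∈ valMod (ZMod 3) (1 : ZMod 3) (↑famB1 : Set (Ty₄ (ZMod 3) → ℤ)) := by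
  have hA := odd_card_zmod_three
  have hdec := kC_decomp (fun j => kOf (ZMod 3) j x) (fun η => fnl (ZMod 3) (wC (ZMod 3) η) x) (fun η => fnl_wC_not (ZMod 3) hA η x)
    (rel01_lit (ZMod 3) hA hx) (rel02_lit (ZMod 3) hA hx) (rel03_lit (ZMod 3) hA hx) (rel4_lit (ZMod 3) hA hx)
  rw [nf_eq_ΦL, hdec, map_sum]
  refine Submodule.sum_mem _ fun l _ => ?_
  rw [map_smul]
  refine Submodule.smul_mem _ _ ?_
  rw [← ΨL_apply, B_eq_sum_G l, map_sum]
  refine Submodule.sum_mem _ fun i _ => ?_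
  rw [map_smul]
  exact Submodule.smul_mem _ _ (ΦL_G_mem i)

/-- **THE LATTICE THEOREM: the value vector of every Hodge vector of the model lies in the value module of `B1`** (`Avec x ∈ Avec (orbSpan B1)`). [folklore] -/
theorem Avec_mem_valMod_of_hodge {x : Ty₄ (ZMod 3) → ℤ} (hx : x ∈ hodge₄ (ZMod 3)) : Avec (ZMod 3) x ∈ valMod (ZMod 3) (1 : ZMod 3) (↑famB1 : Set (Ty₄ (ZMod 3) → ℤ)) :=
  Avec_mem_of_nf_mem (ZMod 3) odd_card_zmod_three binVec_mem_valMod hx (nf_mem_valMod_of_hodge hx)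

end Members

end

end Summit.HodgeConjecture.CorCM.Census.BinaryTetrahedral
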